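import Summits.MatrixMultiplication.MatrixMultiplication.Theorems.LevelGradedCohnUmansGradedDesignFamilyStubTwoRowDegrees

/-!
# `GradedDesignFamily`, stub `stub_twoRowDegrees` (siege k23): assembly from the landed
# two-row lemmas, with equality

Crux `stmt-MatrixMultiplication-7610`
(`Summit.MatrixMultiplication.MatrixMultiplication.Theses.LevelGradedCohnUmans.GradedDesignFamily`),
line `schur-weyl-colour-cells`, registered stub B1 `stub_twoRowDegrees`:
for every `n : ℕ` and every real `s`,
`∑_{μ ⊢ n, #parts μ ≤ 2} (f^μ)^s ≤ ∑_{j ≤ n/2} (C(n,j) (n - 2j + 1) / (n - j + 1))^s`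
(`f^μ = numStandardTableaux μ`, the number of standard Young tableaux of shape `μ`).

Siege variation "reduce to landed lemmas of this crux, then assemble".  The landed file
`LevelGradedCohnUmansGradedDesignFamilyStubTwoRowDegrees.lean` (p101220) supplies the three
reduction lemmas

* `trd_sortedParts_eq` — a shape with `≤ 2` rows and second row `j = λ₂` has `2j ≤ n`;
* `trd_injOn` — such shapes are determined by `j`;
* `trd_numStandardTableaux_eq` — `f^μ = C(n,j) (n - 2j + 1) / (n - j + 1)` (ballot numbers,
  from the tree's Frobenius–Young formula `card_stdFilling_mul_prod_factorial`).

This file adds the converse of the first two — every `j ≤ n/2` IS the second row of a shape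
with at most two rows, namely `(n - j, j)` with its zero rows removed
(`exists_card_le_two_and_getD_eq`), so that `μ ↦ λ₂` is a bijection onto `[0, n/2]`
(`image_getD_eq_range`, `card_filter_card_le_two`) — and assembles the stub as an EQUALITY
of the two power sums (`twoRowDegrees_powerSum_eq`); the registered inequality
`stub_twoRowDegrees` is its `le`.  No case split on `n = 0` is needed: there the unique
(empty) shape has `λ₂ = 0` and both sides equal `1`.
-/

set_option linter.dupNamespace false

noncomputable section

open scoped BigOperators
open Literature.NumberTheory.DiophantineGeometry

namespace Summit.MatrixMultiplication.MatrixMultiplication.Theorems.GradedDesignFamily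

namespace TwoRowBallot

/-- **Two-row shapes exist for every second row `j ≤ n/2`**: the partition of `n` with parts
`n - j, j` (zeros removed) has at most two parts and second sorted part `j`. -/
theorem exists_card_le_two_and_getD_eq {n j : ℕ} (hj : 2 * j ≤ n) :
    ∃ μ : Nat.Partition n, Multiset.card μ.parts ≤ 2 ∧ μ.sortedParts.getD 1 0 = j := by
  classical
  have hsum : ((↑[n - j, j] : Multiset ℕ)).sum = n := by
    rw [Multiset.sum_coe, List.sum_cons, List.sum_cons, List.sum_nil]
    omega
  refine ⟨Nat.Partition.ofSums n _ hsum, ?_, ?_⟩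
  · rw [Nat.Partition.ofSums_parts]
    exact (Multiset.card_le_card (Multiset.filter_le _ _)).trans (by simp)
  · rcases Nat.eq_zero_or_pos j with rfl | hj0
    · -- one row (or none): the sorted parts have length `≤ 1`
      apply List.getD_eq_default
      rw [Nat.Partition.length_sortedParts, Nat.Partition.ofSums_parts, Multiset.filter_coe,
        Multiset.coe_card]
      simp only [Nat.sub_zero, List.filter_cons, List.filter_nil, ne_eq, not_true_eq_false,
        decide_false]
      split <;> simp
    · -- two rows `n - j ≥ j ≥ 1`
      have hparts : (Nat.Partition.ofSums n _ hsum).parts = ↑[n - j, j] := by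
        rw [Nat.Partition.ofSums_parts, Multiset.filter_coe]
        have h1 : n - j ≠ 0 := by omega
        have h2 : j ≠ 0 := hj0.ne'
        simp [h1, h2]
      have hsorted : (Nat.Partition.ofSums n _ hsum).sortedParts = [n - j, j] := by
        change (Nat.Partition.ofSums n _ hsum).parts.sort (· ≥ ·) = _
        rw [hparts, Multiset.coe_sort]
        exact List.mergeSort_eq_self _ (by simp; omega)
      rw [hsorted]
      rfl

/-- **The second row is a bijection onto `[0, n/2]`**: on the partitions of `n` with at most two
parts, the image of `μ ↦ λ₂ = μ.sortedParts.getD 1 0` is exactly `range (n/2 + 1)`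
(`2 λ₂ ≤ n` by `trd_sortedParts_eq`; surjective by `exists_card_le_two_and_getD_eq`). -/
theorem image_getD_eq_range (n : ℕ) :
    (Finset.univ.filter fun μ : Nat.Partition n => Multiset.card μ.parts ≤ 2).image
        (fun μ : Nat.Partition n => μ.sortedParts.getD 1 0) = Finset.range (n / 2 + 1) := by
  ext j
  simp only [Finset.mem_image, Finset.mem_filter, Finset.mem_univ, true_and, Finset.mem_range]
  constructor
  · rintro ⟨μ, hμ, rfl⟩
    have := (trd_sortedParts_eq μ hμ).1
    omega
  · intro hj
    exact exists_card_le_two_and_getD_eq (by omega)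

/-- **There are exactly `n/2 + 1` partitions of `n` with at most two parts**
(`trd_injOn` and `image_getD_eq_range`). -/
theorem card_filter_card_le_two (n : ℕ) :
    (Finset.univ.filter fun μ : Nat.Partition n => Multiset.card μ.parts ≤ 2).card = n / 2 + 1 := by
  rw [← Finset.card_image_of_injOn (trd_injOn n), image_getD_eq_range, Finset.card_range]

/-- **The two-row degree power sum IS the ballot power sum**: for every `n` and real `s`,
`∑_{μ ⊢ n, #parts μ ≤ 2} (f^μ)^s = ∑_{j ≤ n/2} (C(n,j) (n - 2j + 1) / (n - j + 1))^s`
(reindex by the bijection `μ ↦ λ₂` of `image_getD_eq_range` / `trd_injOn`, term by term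
`trd_numStandardTableaux_eq`). -/
theorem twoRowDegrees_powerSum_eq (n : ℕ) (s : ℝ) :
    (∑ μ : Nat.Partition n, if Multiset.card μ.parts ≤ 2 then
        (numStandardTableaux μ : ℝ) ^ s else 0) =
      ∑ j ∈ Finset.range (n / 2 + 1),
        ((n.choose j : ℝ) * ((n : ℝ) - 2 * j + 1) / ((n : ℝ) - j + 1)) ^ s := by
  have hmem : ∀ μ ∈ (Finset.univ.filter fun μ : Nat.Partition n => Multiset.card μ.parts ≤ 2),
      Multiset.card μ.parts ≤ 2 := fun μ hμ => (Finset.mem_filter.1 hμ).2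
  calc (∑ μ : Nat.Partition n, if Multiset.card μ.parts ≤ 2 then
          (numStandardTableaux μ : ℝ) ^ s else 0)
      = ∑ μ ∈ (Finset.univ.filter fun μ : Nat.Partition n => Multiset.card μ.parts ≤ 2),
          (numStandardTableaux μ : ℝ) ^ s :=
        (Finset.sum_filter (fun μ : Nat.Partition n => Multiset.card μ.parts ≤ 2)
          (fun μ => (numStandardTableaux μ : ℝ) ^ s)).symm
    _ = ∑ μ ∈ (Finset.univ.filter fun μ : Nat.Partition n => Multiset.card μ.parts ≤ 2),
          ((n.choose (μ.sortedParts.getD 1 0) : ℝ) *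
              ((n : ℝ) - 2 * (μ.sortedParts.getD 1 0 : ℕ) + 1) /
            ((n : ℝ) - (μ.sortedParts.getD 1 0 : ℕ) + 1)) ^ s :=
        Finset.sum_congr rfl fun μ hμ => by rw [trd_numStandardTableaux_eq μ (hmem μ hμ)]
    _ = ∑ j ∈ (Finset.univ.filter fun μ : Nat.Partition n => Multiset.card μ.parts ≤ 2).image
          (fun μ : Nat.Partition n => μ.sortedParts.getD 1 0),
          ((n.choose j : ℝ) * ((n : ℝ) - 2 * j + 1) / ((n : ℝ) - j + 1)) ^ s :=
        (Finset.sum_image (f := fun j : ℕ =>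
          ((n.choose j : ℝ) * ((n : ℝ) - 2 * j + 1) / ((n : ℝ) - j + 1)) ^ s) (trd_injOn n)).symm
    _ = ∑ j ∈ Finset.range (n / 2 + 1),
          ((n.choose j : ℝ) * ((n : ℝ) - 2 * j + 1) / ((n : ℝ) - j + 1)) ^ s := by
        rw [image_getD_eq_range]

/-- STUB B1 `stub_twoRowDegrees` of the line `schur-weyl-colour-cells` (siege k23, assembled from
the landed two-row lemmas `trd_sortedParts_eq`, `trd_injOn`, `trd_numStandardTableaux_eq` of
p101220 via the bijection `μ ↦ λ₂` onto `[0, n/2]`): the two-row degree power sum equals the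
ballot power sum (`twoRowDegrees_powerSum_eq`), in particular it is at most it. -/
theorem stub_twoRowDegrees : ∀ (n : ℕ) (s : ℝ), (∑ μ : Nat.Partition n, if Multiset.card μ.parts ≤ 2 then (Literature.NumberTheory.DiophantineGeometry.numStandardTableaux μ : ℝ) ^ s else 0) ≤ ∑ j ∈ Finset.range (n / 2 + 1), ((n.choose j : ℝ) * ((n : ℝ) - 2 * j + 1) / ((n : ℝ) - j + 1)) ^ s :=
  fun n s => (twoRowDegrees_powerSum_eq n s).le

end TwoRowBallot

end Summit.MatrixMultiplication.MatrixMultiplication.Theorems.GradedDesignFamily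

end
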